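import Literature.Geometry.Lorentzian.KerrMiddleRegionEnergyBoundedness
import HarnessLib

/-!
# The radial cut-off `ψ̃ = χ(r) ψ` of a solution of the Kerr wave equation and its source
# `F̃ = □_g ψ̃` (Dafermos–Rodnianski–Shlapentokh-Rothman §13.1.2)

(family `gr`; namespaces `Literature.Geometry.Lorentzian.KerrSchild`, `Literature.Geometry.Lorentzian.Kerr`;
proofs only — no definitions, no named facts, D-0026; written from the proving seat of the named fact
`DafermosRodnianskiShlapentokhRothman2016_energyBoundedness_horizonRegular` as producer-side
infrastructure for the hypothesis of
`DafermosRodnianskiShlapentokhRothman2016_energyBoundedness_horizonRegular_of_trappedDecomposition`,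
`KerrHorizonRegularBoundednessPhaseSpaceReduction.lean`.)

In §13.1.2 of arXiv:1402.7034 the (extended) solution `ψ` is cut off radially,
`ψ̃ ≐ χ_{[A₀,A₁]} ψ`, and "`□_g ψ̃ = F̃ ≐ □_g χ ψ + 2∇^μχ ∇_μψ`. Observe that `F̃` has compact support in
`r`, and `|F̃|² ≤ B(|ψ|² + |∂_{r*}ψ|²)`". In the coefficient-field framework of
`KerrSchild.waveOperator` (the divergence-form operator `□_G u = ∂_μ(G^{μν}∂_ν u)`, which for the
Kerr–Schild coefficients `G = Kerr.inverseMetric M a`, `det g = −1`, is the geometric `□_g`) this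
file proves:

* `KerrSchild.waveOperator_mul` — the **Leibniz rule**
  `□_G (f g) = f □_G g + g □_G f + 2 ∑ G^{μν} ∂_μ f ∂_ν g` at a point where `G` is differentiable
  and symmetric and `f`, `g` are `C²` [folklore; the same computation as the Summits-side
  `…AdiabaticMultiKerrILED.Sketch.waveOperator_mul`, which Literature cannot import];
* `Kerr.contDiff_comp_radius_of_eq_zero` — a radial profile `χ ∘ r` with `χ ∈ Cⁿ` vanishing on
  `(-∞, A]`, `A > 0`, is `Cⁿ` on all of `ℝ⁴` (the Kerr–Schild radius is smooth on `{r > 0}`);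
* `Kerr.waveOperator_radialCutoff_mul` — `□_g(χ(r) u) = χ(r) □_g u + u □_g(χ∘r) + 2∑ g^{μν}∂_μ(χ∘r)∂_ν u`
  on `{r > 0}`; `Kerr.waveOperator_radialCutoff_mul_of_eventually_const` — where `χ` is locally
  constant (`χ ≡ c` near `r(x)`), `□_g(χ(r) u)(x) = c □_g u (x)`: the source `F̃` vanishes on the
  middle region `{χ ≡ 1}` and off the support of `χ`;
* `Kerr.exists_sq_waveOperator_radialCutoff_mul_le` — **the source bound**: for `χ ∈ C²` supported
  in `[A₀, A₁]`, `A₀ > 0`, there is `B = B(M, a, χ)` with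
  `(□_g(χ(r)u)(x))² ≤ B (u(x)² + ∑_μ (∂_μ u(x))²)` at every point `x` with `□_g u (x) = 0`
  (stationarity of `g` and of `χ ∘ r` and compactness of `{t* = 0, A₀ ≤ r ≤ A₁}`).

## References

* M. Dafermos, I. Rodnianski, Y. Shlapentokh-Rothman, *Decay for solutions of the wave equation on
  Kerr exterior spacetimes III: the full subextremal case `|a| < M`*, Ann. of Math. 183 (2016),
  arXiv:1402.7034, §13.1.2 (key `DafermosRodnianskiShlapentokhrothman2014`).
-/

noncomputable section

open Set Filter Metric
open scoped Topology ContDiff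

namespace Literature.Geometry.Lorentzian

namespace KerrSchild

/-- **Leibniz rule for the divergence-form wave operator**:
`□_G (f g) = f □_G g + g □_G f + 2 ∑_{μν} G^{μν} ∂_μ f ∂_ν g` at a point where the coefficient field
`G` is differentiable and symmetric and `f`, `g` are `C²`. [folklore] -/
theorem waveOperator_mul {G : E4 → Fin 4 → Fin 4 → ℝ} {f g : E4 → ℝ} {x : E4}
    (hG : ∀ μ ν, DifferentiableAt ℝ (fun y ↦ G y μ ν) x) (hsymm : ∀ μ ν, G x μ ν = G x ν μ)
    (hf : ContDiffAt ℝ 2 f x) (hg : ContDiffAt ℝ 2 g x) :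
    waveOperator G (fun y ↦ f y * g y) x =
      f x * waveOperator G g x + g x * waveOperator G f x +
        2 * ∑ μ, ∑ ν, G x μ ν * fderiv ℝ f x (E4.basisVector μ) * fderiv ℝ g x (E4.basisVector ν) := by
  -- the raised gradients `A_u^μ = ∑_ν G^{μν} ∂_ν u`
  set Af : Fin 4 → E4 → ℝ := fun μ y ↦ ∑ ν, G y μ ν * fderiv ℝ f y (E4.basisVector ν) with hAf
  set Ag : Fin 4 → E4 → ℝ := fun μ y ↦ ∑ ν, G y μ ν * fderiv ℝ g y (E4.basisVector ν) with hAg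
  have hf1 : DifferentiableAt ℝ f x := hf.differentiableAt (by simp)
  have hg1 : DifferentiableAt ℝ g x := hg.differentiableAt (by simp)
  have hdcoord : ∀ {u : E4 → ℝ}, ContDiffAt ℝ 2 u x → ∀ κ,
      DifferentiableAt ℝ (fun y ↦ fderiv ℝ u y (E4.basisVector κ)) x := by
    intro u hu κ
    have hu2 : DifferentiableAt ℝ (fderiv ℝ u) x :=
      (hu.fderiv_right (m := 1) le_rfl).differentiableAt one_ne_zero
    exact hu2.clm_apply (differentiableAt_const _)
  have hdAf : ∀ μ, DifferentiableAt ℝ (Af μ) x := fun μ ↦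
    DifferentiableAt.fun_sum fun ν _ ↦ (hG μ ν).mul (hdcoord hf ν)
  have hdAg : ∀ μ, DifferentiableAt ℝ (Ag μ) x := fun μ ↦
    DifferentiableAt.fun_sum fun ν _ ↦ (hG μ ν).mul (hdcoord hg ν)
  -- near `x` both factors are differentiable, so `A_{fg} = f A_g + g A_f` there
  have hfn : ∀ᶠ y in 𝓝 x, DifferentiableAt ℝ f y := by
    have h := hf.eventually (by simp : (2 : WithTop ℕ∞) ≠ ∞)
    filter_upwards [h] with y hy using hy.differentiableAt (by simp)
  have hgn : ∀ᶠ y in 𝓝 x, DifferentiableAt ℝ g y := by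
    have h := hg.eventually (by simp : (2 : WithTop ℕ∞) ≠ ∞)
    filter_upwards [h] with y hy using hy.differentiableAt (by simp)
  have hinner : ∀ μ, (fun y ↦ ∑ ν, G y μ ν * fderiv ℝ (fun z ↦ f z * g z) y (E4.basisVector ν))
      =ᶠ[𝓝 x] fun y ↦ f y * Ag μ y + g y * Af μ y := by
    intro μ
    filter_upwards [hfn, hgn] with y hfy hgy
    have hprod : fderiv ℝ (fun z ↦ f z * g z) y = f y • fderiv ℝ g y + g y • fderiv ℝ f y :=
      (hfy.hasFDerivAt.mul hgy.hasFDerivAt).fderiv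
    simp only [hprod, add_apply, smul_apply, smul_eq_mul, hAf, hAg, Finset.mul_sum]
    rw [← Finset.sum_add_distrib]
    exact Finset.sum_congr rfl fun ν _ ↦ by ring
  -- differentiate at `x`
  have hderiv : ∀ μ, fderiv ℝ (fun y ↦ ∑ ν, G y μ ν *
      fderiv ℝ (fun z ↦ f z * g z) y (E4.basisVector ν)) x (E4.basisVector μ) =
      (f x * fderiv ℝ (Ag μ) x (E4.basisVector μ) + fderiv ℝ f x (E4.basisVector μ) * Ag μ x) +
        (g x * fderiv ℝ (Af μ) x (E4.basisVector μ) + fderiv ℝ g x (E4.basisVector μ) * Af μ x) := by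
    intro μ
    rw [(hinner μ).fderiv_eq]
    have h1 := hf1.hasFDerivAt.mul (hdAg μ).hasFDerivAt
    have h2 := hg1.hasFDerivAt.mul (hdAf μ).hasFDerivAt
    have h12 : HasFDerivAt (fun y ↦ f y * Ag μ y + g y * Af μ y) _ x := h1.add h2
    rw [h12.fderiv]
    simp only [add_apply, smul_apply, smul_eq_mul]
    ring
  have hboxf : waveOperator G f x = ∑ μ, fderiv ℝ (Af μ) x (E4.basisVector μ) := rfl
  have hboxg : waveOperator G g x = ∑ μ, fderiv ℝ (Ag μ) x (E4.basisVector μ) := rfl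
  have hboxfg : waveOperator G (fun y ↦ f y * g y) x = ∑ μ, fderiv ℝ (fun y ↦ ∑ ν, G y μ ν *
      fderiv ℝ (fun z ↦ f z * g z) y (E4.basisVector ν)) x (E4.basisVector μ) := rfl
  rw [hboxfg, hboxf, hboxg]
  simp only [hderiv]
  -- the cross terms `∑_μ ∂_μf A_g^μ = ∑ G ∂f ∂g = ∑_μ ∂_μg A_f^μ` (symmetry of `G`)
  have hc1 : ∑ μ, fderiv ℝ f x (E4.basisVector μ) * Ag μ x =
      ∑ μ, ∑ ν, G x μ ν * fderiv ℝ f x (E4.basisVector μ) * fderiv ℝ g x (E4.basisVector ν) := by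
    simp only [hAg, Finset.mul_sum]
    exact Finset.sum_congr rfl fun μ _ ↦ Finset.sum_congr rfl fun ν _ ↦ by ring
  have hc2 : ∑ μ, fderiv ℝ g x (E4.basisVector μ) * Af μ x =
      ∑ μ, ∑ ν, G x μ ν * fderiv ℝ f x (E4.basisVector μ) * fderiv ℝ g x (E4.basisVector ν) := by
    simp only [hAf, Finset.mul_sum]
    rw [Finset.sum_comm]
    exact Finset.sum_congr rfl fun ν _ ↦ Finset.sum_congr rfl fun μ _ ↦ by rw [hsymm μ ν]; ring
  have hsplit : ∑ μ, ((f x * fderiv ℝ (Ag μ) x (E4.basisVector μ) +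
      fderiv ℝ f x (E4.basisVector μ) * Ag μ x) +
        (g x * fderiv ℝ (Af μ) x (E4.basisVector μ) + fderiv ℝ g x (E4.basisVector μ) * Af μ x)) =
      f x * ∑ μ, fderiv ℝ (Ag μ) x (E4.basisVector μ) +
        ∑ μ, fderiv ℝ f x (E4.basisVector μ) * Ag μ x +
        (g x * ∑ μ, fderiv ℝ (Af μ) x (E4.basisVector μ) +
          ∑ μ, fderiv ℝ g x (E4.basisVector μ) * Af μ x) := by
    simp only [Finset.mul_sum, ← Finset.sum_add_distrib]
  rw [hsplit, hc1, hc2]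
  ring

end KerrSchild

namespace Kerr

variable {M a : ℝ}

/-! ## Radial profiles `χ ∘ r` -/

/-- A radial profile `x ↦ χ(r(x))` with `χ ∈ Cⁿ` vanishing on `(-∞, A]` for some `A > 0` is `Cⁿ` on
all of `ℝ⁴`: the Kerr–Schild radius is smooth on `{r > 0}` (`Kerr.contDiffAt_radius`), and the
profile vanishes identically on the open set `{r < A}`. [folklore] -/
theorem contDiff_comp_radius_of_eq_zero (a : ℝ) {χ : ℝ → ℝ} {n : WithTop ℕ∞} (hχ : ContDiff ℝ n χ)
    {A : ℝ} (hA : 0 < A) (h0 : ∀ r ≤ A, χ r = 0) :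
    ContDiff ℝ n fun x : E4 ↦ χ (radius a x) := by
  refine contDiff_iff_contDiffAt.mpr fun x ↦ ?_
  by_cases hx : A / 2 < radius a x
  · exact hχ.contDiffAt.comp x (contDiffAt_radius (by linarith))
  · have hev : (fun y : E4 ↦ χ (radius a y)) =ᶠ[𝓝 x] fun _ ↦ 0 := by
      have hopen : IsOpen {y : E4 | radius a y < A} := isOpen_lt (continuous_radius a) continuous_const
      filter_upwards [hopen.mem_nhds (show radius a x < A by linarith [not_lt.mp hx])] with y hy
      exact h0 _ (le_of_lt hy)
    exact contDiffAt_const.congr_of_eventuallyEq hev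

/-- A radial profile is invariant under `t*`-translations. [folklore] -/
theorem comp_radius_add_smul_basisVector_zero (a : ℝ) (χ : ℝ → ℝ) (x : E4) (t : ℝ) :
    χ (radius a (x + t • E4.basisVector 0)) = χ (radius a x) := by
  rw [radius_add_time_smul_basisVector]

/-! ## The Leibniz rule for the radial cut-off -/

/-- **`□_g(χ(r) u) = χ(r) □_g u + u □_g(χ∘r) + 2 ∑ g^{μν} ∂_μ(χ∘r) ∂_ν u`** on `{r > 0}`, for the Kerr
coefficient field `g^{μν} = Kerr.inverseMetric M a` (smooth and symmetric there), `χ ∈ C²` and `u`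
of class `C²` at the point (`KerrSchild.waveOperator_mul`). This is
"`□_g ψ̃ = □_g χ ψ + 2∇^μ χ ∇_μ ψ`" of arXiv:1402.7034, §13.1.2, before `□_g ψ = 0` is used.
[cite: DafermosRodnianskiShlapentokhrothman2014, §13.1.2] -/
theorem waveOperator_radialCutoff_mul (M a : ℝ) {χ : ℝ → ℝ} (hχ : ContDiff ℝ 2 χ) {u : E4 → ℝ}
    {x : E4} (hx : 0 < radius a x) (hu : ContDiffAt ℝ 2 u x) :
    KerrSchild.waveOperator (inverseMetric M a) (fun y ↦ χ (radius a y) * u y) x =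
      χ (radius a x) * KerrSchild.waveOperator (inverseMetric M a) u x +
        u x * KerrSchild.waveOperator (inverseMetric M a) (fun y ↦ χ (radius a y)) x +
        2 * ∑ μ, ∑ ν, inverseMetric M a x μ ν *
          fderiv ℝ (fun y ↦ χ (radius a y)) x (E4.basisVector μ) * fderiv ℝ u x (E4.basisVector ν) :=
  KerrSchild.waveOperator_mul
    (fun μ ν ↦ (contDiffAt_inverseMetric M a hx μ ν (n := 1)).differentiableAt one_ne_zero)
    (inverseMetric_symm M a x) (hχ.contDiffAt.comp x (contDiffAt_radius hx)) hu

/-- **The source of the cut-off solution**: where `□_g u = 0`,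
`□_g(χ(r) u) = u □_g(χ∘r) + 2 ∑ g^{μν} ∂_μ(χ∘r) ∂_ν u` — the `F̃` of arXiv:1402.7034, §13.1.2.
[cite: DafermosRodnianskiShlapentokhrothman2014, §13.1.2] -/
theorem waveOperator_radialCutoff_mul_of_waveOperator_eq_zero (M a : ℝ) {χ : ℝ → ℝ}
    (hχ : ContDiff ℝ 2 χ) {u : E4 → ℝ} {x : E4} (hx : 0 < radius a x) (hu : ContDiffAt ℝ 2 u x)
    (hbox : KerrSchild.waveOperator (inverseMetric M a) u x = 0) :
    KerrSchild.waveOperator (inverseMetric M a) (fun y ↦ χ (radius a y) * u y) x =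
      u x * KerrSchild.waveOperator (inverseMetric M a) (fun y ↦ χ (radius a y)) x +
        2 * ∑ μ, ∑ ν, inverseMetric M a x μ ν *
          fderiv ℝ (fun y ↦ χ (radius a y)) x (E4.basisVector μ) * fderiv ℝ u x (E4.basisVector ν) := by
  rw [waveOperator_radialCutoff_mul M a hχ hx hu, hbox, mul_zero, zero_add]

/-- **The source vanishes where the profile is locally constant**: if `χ ≡ c` on a neighbourhood of
`r(x)` then `□_g(χ(r) u)(x) = c □_g u (x)` (no regularity needed: the wave operator is local and
`∂(c u) = c ∂u`). In arXiv:1402.7034, §13.1.2 this is the support statement for `F̃`: it vanishes on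
the middle region `{χ ≡ 1}` (where `□_g ψ̃ = □_g ψ = 0`) and off the support of `χ`.
[cite: DafermosRodnianskiShlapentokhrothman2014, §13.1.2] -/
theorem waveOperator_radialCutoff_mul_of_eventually_const (G : E4 → Fin 4 → Fin 4 → ℝ) (a : ℝ)
    {χ : ℝ → ℝ} {c : ℝ} {x : E4} (hχ : ∀ᶠ r in 𝓝 (radius a x), χ r = c) (u : E4 → ℝ) :
    KerrSchild.waveOperator G (fun y ↦ χ (radius a y) * u y) x =
      c * KerrSchild.waveOperator G u x := by
  -- near `x` the cut-off function is `c u`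
  have hev : (fun y ↦ χ (radius a y) * u y) =ᶠ[𝓝 x] fun y ↦ c * u y := by
    have h := (continuous_radius a).continuousAt.eventually hχ
    filter_upwards [h] with y hy
    rw [hy]
  -- `∂(c u) = c ∂u` everywhere (with or without differentiability)
  have hfd : ∀ y : E4, fderiv ℝ (fun z ↦ c * u z) y = c • fderiv ℝ u y := by
    intro y
    by_cases hc : c = 0
    · simp [hc]
    by_cases hd : DifferentiableAt ℝ u y
    · exact (hd.hasFDerivAt.const_mul c).fderiv
    · have hd' : ¬DifferentiableAt ℝ (fun z ↦ c * u z) y := by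
        intro h
        apply hd
        have h2 : (fun z ↦ u z) = fun z ↦ c⁻¹ * (c * u z) := by
          funext z; field_simp
        rw [show u = fun z ↦ u z from rfl, h2]
        exact h.const_mul c⁻¹
      rw [fderiv_zero_of_not_differentiableAt hd, fderiv_zero_of_not_differentiableAt hd', smul_zero]
  have hev' : ∀ᶠ y in 𝓝 x, (fun z ↦ χ (radius a z) * u z) =ᶠ[𝓝 y] fun z ↦ c * u z :=
    hev.eventually_nhds
  unfold KerrSchild.waveOperator
  rw [Finset.mul_sum]
  refine Finset.sum_congr rfl fun μ _ ↦ ?_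
  have hin : (fun y ↦ ∑ ν, G y μ ν * fderiv ℝ (fun z ↦ χ (radius a z) * u z) y (E4.basisVector ν))
      =ᶠ[𝓝 x] fun y ↦ c * ∑ ν, G y μ ν * fderiv ℝ u y (E4.basisVector ν) := by
    filter_upwards [hev'] with y hy
    rw [hy.fderiv_eq, hfd y, Finset.mul_sum]
    simp only [smul_apply, smul_eq_mul]
    exact Finset.sum_congr rfl fun ν _ ↦ by ring
  rw [hin.fderiv_eq]
  -- `∂(c v) = c ∂v` once more
  have h2 : fderiv ℝ (fun y ↦ c * ∑ ν, G y μ ν * fderiv ℝ u y (E4.basisVector ν)) x =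
      c • fderiv ℝ (fun y ↦ ∑ ν, G y μ ν * fderiv ℝ u y (E4.basisVector ν)) x := by
    by_cases hc : c = 0
    · simp [hc]
    set v : E4 → ℝ := fun y ↦ ∑ ν, G y μ ν * fderiv ℝ u y (E4.basisVector ν) with hv
    by_cases hd : DifferentiableAt ℝ v x
    · exact (hd.hasFDerivAt.const_mul c).fderiv
    · have hd' : ¬DifferentiableAt ℝ (fun z ↦ c * v z) x := by
        intro h
        apply hd
        have h3 : v = fun z ↦ c⁻¹ * (c * v z) := by
          funext z; field_simp
        rw [h3]
        exact h.const_mul c⁻¹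
      rw [fderiv_zero_of_not_differentiableAt hd, fderiv_zero_of_not_differentiableAt hd', smul_zero]
  rw [h2, smul_apply, smul_eq_mul]

/-! ## The source bound `|F̃|² ≤ B (|u|² + |∂u|²)` -/

/-- **The source of the radial cut-off is bounded by the first-order energy density**
(arXiv:1402.7034, §13.1.2: "`|F̃|² ≤ B(|ψ|² + |∂_{r*}ψ|²)`", here with the full coordinate
gradient). Let `χ ∈ C²(ℝ)` be supported in `[A₀, A₁]` with `A₀ > 0`. There is `B = B(M, a, χ) ≥ 0`
such that for every function `u` of class `C²` at a point `x` with `□_g u (x) = 0`,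
`(□_g (χ(r) u)(x))² ≤ B (u(x)² + ∑_μ (∂_μ u (x))²)`. Proof: by
`Kerr.waveOperator_radialCutoff_mul`, `□_g(χ(r)u) = u □_g(χ∘r) + ∑_ν β^ν ∂_ν u` with
`β^ν = 2∑_μ g^{μν} ∂_μ(χ∘r)`; the coefficients `□_g(χ∘r)` and `β^ν` are continuous, invariant under
`t*`-translations and (the first) supported in the slab `{A₀ ≤ r ≤ A₁}`, hence bounded there
(`Kerr.exists_forall_abs_le_of_continuousOn_slab`: compactness of `{t* = 0} ∩ {A₀ ≤ r ≤ A₁}`);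
off the slab the cut-off function vanishes near `x`; conclude by Cauchy–Schwarz.
[cite: DafermosRodnianskiShlapentokhrothman2014, §13.1.2] -/
theorem exists_sq_waveOperator_radialCutoff_mul_le (M a : ℝ) {A₀ A₁ : ℝ} (hA₀ : 0 < A₀)
    {χ : ℝ → ℝ} (hχ : ContDiff ℝ 2 χ) (hχs : ∀ r, χ r ≠ 0 → A₀ ≤ r ∧ r ≤ A₁) :
    ∃ B : ℝ, 0 ≤ B ∧ ∀ (u : E4 → ℝ) (x : E4), ContDiffAt ℝ 2 u x →
      KerrSchild.waveOperator (inverseMetric M a) u x = 0 →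
      (KerrSchild.waveOperator (inverseMetric M a) (fun y ↦ χ (radius a y) * u y) x) ^ 2 ≤
        B * (u x ^ 2 + ∑ μ, fderiv ℝ u x (E4.basisVector μ) ^ 2) := by
  -- the profile `w = χ ∘ r` on `ℝ⁴`
  set w : E4 → ℝ := fun y ↦ χ (radius a y) with hw_def
  have hχ0 : ∀ r, r < A₀ → χ r = 0 := fun r hr ↦ by
    by_contra h
    exact absurd (hχs r h).1 (not_le.mpr hr)
  have hw : ContDiff ℝ 2 w :=
    contDiff_comp_radius_of_eq_zero a hχ (half_pos hA₀) fun r hr ↦ hχ0 r (by linarith)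
  have hsupp : ∀ y, w y ≠ 0 → A₀ ≤ radius a y ∧ radius a y ≤ A₁ := fun y hy ↦ hχs _ hy
  have hwinv : ∀ (y : E4) (t : ℝ), w (y + t • E4.basisVector 0) = w y := fun y t ↦
    comp_radius_add_smul_basisVector_zero a χ y t
  -- the coefficient `α = □_g(χ∘r)`: continuous, stationary, hence bounded on the slab
  set α : E4 → ℝ := KerrSchild.waveOperator (inverseMetric M a) w with hα
  have hαc : Continuous α := (continuous_waveOperator_of_support_slab M hw hA₀ hsupp).1
  have hαinv : ∀ (y : E4) (t : ℝ), α (y + t • E4.basisVector 0) = α y := by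
    intro y t
    have h := KerrSchild.waveOperator_comp_add_right (v := t • E4.basisVector 0)
      (fun z μ ν ↦ inverseMetric_add_smul_basisVector_zero M a z t μ ν) w y
    have hw' : (fun z ↦ w (z + t • E4.basisVector 0)) = w := funext fun z ↦ hwinv z t
    rw [hw'] at h
    exact h.symm
  obtain ⟨Cα, hCα⟩ := exists_forall_abs_le_of_continuousOn_slab a hA₀ α hαc.continuousOn hαinv
    (R := A₁)
  -- the coefficients `β^ν = 2 ∑_μ g^{μν} ∂_μ(χ∘r)`: continuous on `{r > 0}`, stationary, bounded
  set β : Fin 4 → E4 → ℝ := fun ν y ↦ 2 * ∑ μ, inverseMetric M a y μ ν *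
    fderiv ℝ w y (E4.basisVector μ) with hβ
  have hdwc : ∀ μ, Continuous fun y ↦ fderiv ℝ w y (E4.basisVector μ) := fun μ ↦
    (KerrSchild.contDiff_fderiv_apply_basisVector hw μ).continuous
  have hβc : ∀ ν, ContinuousOn (β ν) {y | 0 < radius a y} := by
    intro ν y hy
    refine (continuousAt_const.mul (tendsto_finsetSum _ fun μ _ ↦ ?_)).continuousWithinAt
    exact ((contDiffAt_inverseMetric M a hy μ ν (n := 0)).continuousAt).mul (hdwc μ).continuousAt
  have hβinv : ∀ ν (y : E4) (t : ℝ), β ν (y + t • E4.basisVector 0) = β ν y := by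
    intro ν y t
    simp only [hβ, inverseMetric_add_smul_basisVector_zero,
      fderiv_add_smul_basisVector_zero_of_invariant hwinv]
  have hCβ : ∀ ν, ∃ C : ℝ, ∀ y : E4, A₀ ≤ radius a y → radius a y ≤ A₁ → |β ν y| ≤ C := fun ν ↦
    exists_forall_abs_le_of_continuousOn_slab a hA₀ (β ν) (hβc ν) (hβinv ν)
  choose Cβ hCβ using hCβ
  set Cb : ℝ := ∑ ν, Cβ ν ^ 2 with hCb
  -- the constant
  refine ⟨2 * Cα ^ 2 + 2 * Cb, by positivity, fun u x hu hbox ↦ ?_⟩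
  set p : Fin 4 → ℝ := fun ν ↦ fderiv ℝ u x (E4.basisVector ν) with hp
  have hP : 0 ≤ ∑ ν, p ν ^ 2 := Finset.sum_nonneg fun ν _ ↦ sq_nonneg _
  by_cases hsl : A₀ ≤ radius a x ∧ radius a x ≤ A₁
  · -- on the slab: Leibniz rule and the bounds on the coefficients
    have hx : 0 < radius a x := hA₀.trans_le hsl.1
    have hF : KerrSchild.waveOperator (inverseMetric M a) (fun y ↦ χ (radius a y) * u y) x =
        u x * α x + ∑ ν, β ν x * p ν := by
      rw [waveOperator_radialCutoff_mul_of_waveOperator_eq_zero M a hχ hx hu hbox]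
      simp only [hα, hβ, hp, hw_def, Finset.mul_sum, Finset.sum_mul]
      rw [Finset.sum_comm]
      refine congrArg₂ (· + ·) rfl (Finset.sum_congr rfl fun ν _ ↦ Finset.sum_congr rfl fun μ _ ↦ ?_)
      ring
    have h1 : (u x * α x) ^ 2 ≤ Cα ^ 2 * u x ^ 2 := by
      have hαb : |α x| ≤ Cα := hCα x hsl.1 hsl.2
      have : α x ^ 2 ≤ Cα ^ 2 := by
        rw [← sq_abs (α x)]
        exact pow_le_pow_left₀ (abs_nonneg _) hαb 2
      nlinarith [sq_nonneg (u x)]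
    have h2 : (∑ ν, β ν x * p ν) ^ 2 ≤ Cb * ∑ ν, p ν ^ 2 := by
      have hcs := Finset.sum_mul_sq_le_sq_mul_sq (Finset.univ : Finset (Fin 4)) (fun ν ↦ β ν x) p
      have hb : ∑ ν, β ν x ^ 2 ≤ Cb := by
        refine Finset.sum_le_sum fun ν _ ↦ ?_
        rw [← sq_abs (β ν x)]
        exact pow_le_pow_left₀ (abs_nonneg _) (hCβ ν x hsl.1 hsl.2) 2
      exact hcs.trans (mul_le_mul_of_nonneg_right hb hP)
    calc (KerrSchild.waveOperator (inverseMetric M a) (fun y ↦ χ (radius a y) * u y) x) ^ 2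
        = (u x * α x + ∑ ν, β ν x * p ν) ^ 2 := by rw [hF]
      _ ≤ 2 * (u x * α x) ^ 2 + 2 * (∑ ν, β ν x * p ν) ^ 2 := by
          nlinarith [sq_nonneg (u x * α x - ∑ ν, β ν x * p ν)]
      _ ≤ 2 * (Cα ^ 2 * u x ^ 2) + 2 * (Cb * ∑ ν, p ν ^ 2) := by linarith
      _ ≤ (2 * Cα ^ 2 + 2 * Cb) * (u x ^ 2 + ∑ ν, p ν ^ 2) := by
          have hCb0 : 0 ≤ Cb := Finset.sum_nonneg fun ν _ ↦ sq_nonneg _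
          nlinarith [sq_nonneg (u x), sq_nonneg Cα, mul_nonneg hCb0 (sq_nonneg (u x)),
            mul_nonneg (sq_nonneg Cα) hP]
  · -- off the slab the cut-off function vanishes near `x`
    have hev : ∀ᶠ r in 𝓝 (radius a x), χ r = 0 := by
      rcases not_and_or.mp hsl with h | h
      · have hlt : radius a x < A₀ := not_le.mp h
        filter_upwards [(isOpen_gt' A₀).mem_nhds hlt] with r hr using hχ0 r hr
      · have hgt : A₁ < radius a x := not_le.mp h
        filter_upwards [(isOpen_lt' A₁).mem_nhds hgt] with r hr
        by_contra hne
        exact absurd (hχs r hne).2 (not_le.mpr hr)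
    rw [waveOperator_radialCutoff_mul_of_eventually_const (inverseMetric M a) a hev u, zero_mul]
    have hB : 0 ≤ 2 * Cα ^ 2 + 2 * Cb := by positivity
    have : 0 ≤ u x ^ 2 + ∑ ν, p ν ^ 2 := by positivity
    simpa using mul_nonneg hB this

end Kerr

end Literature.Geometry.Lorentzian
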